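import Summits.NavierStokesRegularity.NavierStokesRegularity.Theorems.OddMorawetzOddMorawetzLocalActSignedPerm
import Summits.NavierStokesRegularity.NavierStokesRegularity.Theorems.OddMorawetzOddMorawetzLocalCoeffSemantics
import HarnessLib

/-!
# A `B₃`-fixed coefficient vector is a combination of normalised orbit sums

Crux `OddMorawetzLocal` (item stmt-NavierStokesRegularity-1376), refutation skeleton, stub `fixed_b3_span`
(step E1).  Elementary linear algebra over the tree's computable jet algebra
(`OddMorawetzLocal/Negative/OddMorawetzLocalJetAlgebra.lean`, `…RefutationDefs.lean`); Mathlib plus the landed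
`act_signedPerm` (`…ActSignedPerm`) and `coeffOf_cons` / `coeffOf_smul` / `coeffOf_orbitSum` / `coeffOf_nil`
(`…CoeffSemantics`); no named facts, no new definitions.

After the isotropic reduction the coefficient vector `w : V k` of the certificate density is fixed by the matrix
`actMatrix k g` of every signed permutation matrix `g = signedPermMatrix σ ε` (the 48 elements of the
hyperoctahedral group `B₃`, listed in `b3List`).  We AVERAGE over the list:

* `actMatrix_signedPermMatrix_mulVec` — by `act_signedPerm` the matrix of a signed permutation is monomial:
  `(actMatrix k g *ᵥ w) i = Σ_j w j · [idx i = (g · idx j)] · sign(g, idx j)`;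
* `length_mul_eq_sum_coeffOf` — summing the fixed-point equations over a list `l` of signed permutations gives
  `|l| · w i = Σ_j w j · coeffOf (raw signed images of idx j under l) (idx i)` (induction on `l`, `coeffOf_cons`);
* for `l = b3List` the raw list has the coefficients of the collected orbit sum (`coeffOf_orbitSum`), so
  `48 · w = Σ_j w j · (coefficient vector of orbitSum (idx j))`;
* by hypothesis (the kernel certificate `e1Check`, unfolded by `e1Check_spec`) every `orbitSum (idx j)` is `[]` or
  `c • orbitSumN rep` for a LISTED representative `rep = reps[r]`, whence `w` lies in the real span of the
  coefficient vectors of the `orbitSumN (reps[r])` (`fixed_b3_span`).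
-/

noncomputable section

set_option linter.dupNamespace false
set_option autoImplicit false

namespace Summit.NavierStokesRegularity.NavierStokesRegularity.Theorems.OddMorawetz

open CoeffSemantics

/-- **Entry formula.**  The matrix of a signed permutation on the monomial basis is monomial: the `i`-th entry of
`actMatrix k (signedPermMatrix σ ε) *ᵥ w` collects `w j · sign` over the basis monomials `idx j` whose signed image
is `idx i`. -/
theorem actMatrix_signedPermMatrix_mulVec (k : ℕ) (σ : Equiv.Perm (Fin 3)) (ε : Fin 3 → Bool) (w : V k)
    (i : Fin (idx k).length) :
    (actMatrix k (signedPermMatrix σ ε : Matrix (Fin 3) (Fin 3) ℝ)).mulVec w i =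
      ∑ j, w j * (if (idx k).get i = (permAct σ ε ((idx k).get j)).2
        then ((permAct σ ε ((idx k).get j)).1 : ℝ) else 0) := by
  rw [Matrix.mulVec_apply_eq_sum]
  refine Finset.sum_congr rfl fun j _ => ?_
  rw [mul_comm]
  congr 1
  unfold actMatrix
  rw [Matrix.of_apply, act_signedPerm, one_mul]

/-- **Averaging over a list of signed permutations.**  If `w` is fixed by the action matrix of every signed
permutation of the list `l`, then `|l| · w i = Σ_j w j · coeffOf (raw signed images of idx j under l) (idx i)`. -/
theorem length_mul_eq_sum_coeffOf (k : ℕ) (w : V k) (i : Fin (idx k).length)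
    (l : List (Equiv.Perm (Fin 3) × (Fin 3 → Bool)))
    (h : ∀ g ∈ l, (actMatrix k (signedPermMatrix g.1 g.2 : Matrix (Fin 3) (Fin 3) ℝ)).mulVec w = w) :
    (l.length : ℝ) * w i =
      ∑ j, w j * ((JPoly.coeffOf (l.map fun g => ((permAct g.1 g.2 ((idx k).get j)).1,
        (permAct g.1 g.2 ((idx k).get j)).2)) ((idx k).get i) : ℤ) : ℝ) := by
  induction l with
  | nil => simp [coeffOf_nil]
  | cons g l ih =>
    have hg := congrFun (h g List.mem_cons_self) i
    rw [actMatrix_signedPermMatrix_mulVec] at hg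
    simp only [List.map_cons, coeffOf_cons, Int.cast_add, Int.cast_ite, Int.cast_zero, mul_add,
      Finset.sum_add_distrib, List.length_cons, Nat.cast_succ]
    rw [hg, ← ih fun g' hg' => h g' (List.mem_cons_of_mem _ hg')]
    ring

/-- `b3List` lists 48 signed permutations. -/
theorem length_b3List : b3List.length = 48 := by
  simp [b3List, permList, signList]

/-- **Stub `fixed_b3_span` of crux `OddMorawetzLocal` (refutation, step E1).**  A coefficient vector `w : V k`
fixed by the action matrices of the 48 signed permutation matrices is a real linear combination of the coefficient
vectors of the normalised orbit sums `orbitSumN (reps[r])` of the listed representatives, provided every basis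
monomial has orbit sum `[]` or `c • orbitSumN (reps[r])` for a listed `r` (the output of `e1Check_spec`). -/
theorem fixed_b3_span (k : ℕ) (reps : List (List JVar)) (w : V k)
    (he : ∀ i : Fin (idx k).length, orbitSum ((idx k).get i) = [] ∨
      ∃ (r : ℕ) (c : ℤ), r < reps.length ∧ reps.getD r [] = (minImage ((idx k).get i)).2 ∧
        orbitSum ((idx k).get i) = JPoly.smul c (orbitSumN (reps.getD r [])))
    (hfix : ∀ g ∈ b3List,
      (actMatrix k (signedPermMatrix g.1 g.2 : Matrix (Fin 3) (Fin 3) ℝ)).mulVec w = w) :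
    ∃ c : Fin reps.length → ℝ,
      w = ∑ r, c r • (fun i => ((JPoly.coeffOf (orbitSumN (reps.get r)) ((idx k).get i) : ℤ) : ℝ)) := by
  classical
  -- (c) every orbit column lies in the span of the normalised orbit sums of the listed representatives
  have hspan : ∀ j : Fin (idx k).length, ∃ d : Fin reps.length → ℝ, ∀ i : Fin (idx k).length,
      ((JPoly.coeffOf (orbitSum ((idx k).get j)) ((idx k).get i) : ℤ) : ℝ) =
        ∑ r, d r * ((JPoly.coeffOf (orbitSumN (reps.get r)) ((idx k).get i) : ℤ) : ℝ) := by
    intro j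
    rcases he j with h0 | ⟨r, c, hr, -, hrc⟩
    · refine ⟨fun _ => 0, fun i => ?_⟩
      rw [h0, coeffOf_nil]
      simp
    · refine ⟨fun r' => if r' = ⟨r, hr⟩ then (c : ℝ) else 0, fun i => ?_⟩
      rw [hrc, coeffOf_smul, Int.cast_mul]
      simp only [ite_mul, zero_mul, Finset.sum_ite_eq', Finset.mem_univ, if_true]
      rw [List.getD_eq_getElem reps [] hr]
      simp
  choose d hd using hspan
  -- (b) averaging the fixed-point equations over the 48 signed permutations
  have h48 : ∀ i : Fin (idx k).length, (48 : ℝ) * w i =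
      ∑ j, w j * ((JPoly.coeffOf (orbitSum ((idx k).get j)) ((idx k).get i) : ℤ) : ℝ) := by
    intro i
    have h := length_mul_eq_sum_coeffOf k w i b3List hfix
    rw [length_b3List] at h
    simp only [coeffOf_orbitSum]
    rw [← h]
    norm_num
  -- assemble: `w = 48⁻¹ Σ_j w j Σ_r d j r O_r = Σ_r (48⁻¹ Σ_j w j d j r) O_r`
  refine ⟨fun r => 48⁻¹ * ∑ j, w j * d j r, ?_⟩
  funext i
  simp only [Finset.sum_apply, Pi.smul_apply, smul_eq_mul]
  have hw : w i = 48⁻¹ * ∑ j, w j * ((JPoly.coeffOf (orbitSum ((idx k).get j)) ((idx k).get i) : ℤ) : ℝ) := by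
    rw [← h48 i, ← mul_assoc, inv_mul_cancel₀ (by norm_num : (48 : ℝ) ≠ 0), one_mul]
  rw [hw]
  simp only [hd, Finset.mul_sum, Finset.sum_mul]
  rw [Finset.sum_comm]
  refine Finset.sum_congr rfl fun r _ => Finset.sum_congr rfl fun j _ => ?_
  ring

end Summit.NavierStokesRegularity.NavierStokesRegularity.Theorems.OddMorawetz

end
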